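import Literature.IUT.HodgeArakelov.ThetaEvaluationCor112AtModelTateSection
import Literature.AnabelianGeometry.EtaleTheta.ContH1Discrete
import Literature.AnabelianGeometry.EtaleTheta.ContH1Injectivity
import Literature.AnabelianGeometry.EtaleTheta.ContH1ConjAction
import HarnessLib

/-!
# The theta class of the Tate model DIES on the Galois section: a root of `η̈♯|_{Π^tp_{Ÿ̲̲}}` restricts to `inr(G_{ℚ_p})` as an
# `l`-torsion class, so the ROOT member of `η̈^{Θ,l·ℤ×μ₂}` is of STANDARD TYPE at the model's `μ_-` (proof-only; D-0079 K-L6)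

S. Mochizuki, *Inter-universal Teichmüller theory II*, kurims manuscript (Dec. 2020), Rmk. 1.4.1 (ii) pp. 28–29 («its restriction to
`D_{μ_-}` [is] a `2l`-th root of unity» — standard type), Prop. 1.4 p. 27 [claim: Mochizuki2012, status: disputed] (IUTchII §1 Rmk
1.4.1 (ii), kurims p.29); S. Mochizuki, *The étale theta function …*, Publ. RIMS **45** (2009) [EtTh], Prop. 1.4 (iii) p. 22, Prop. 1.5
(iii) p. 23 (the class `η̈^Θ`), Def. 2.7 p. 41 (the root `η̲̈^Θ`) [cite: MochizukiEtTh2009, Prop 1.5 (iii) p.23]; J. Neukirch, A. Schmidt,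
K. Wingberg, *Cohomology of Number Fields*, I §2 [cite: NeukirchSchmidtWingberg2008, I §2 and II §7].  Cell `abc-iut`, seat abc-iut-w4-d043
(gen 8), row «HSTD-AT-SECTION» (STATUS 22:39:10Z), file 1/2 — sequel of `ThetaEvaluationCor112AtModelTateSection` (p472143).
PROOF-ONLY: no definition, no instance, no new named fact; abc-iut-L2's `zPartχq` / `zFunχq` / `etaDdχq` (+ `mul_refReprχq_inv_eq_inl`,
`yCoordχq_apply`) and the `ContH1` API (`mk_eq_mk_iff`, `mk_eq_one_iff`) consumed BY NAME.

WHAT (every stage-2 model `modelχq p i j hj`, every étale-theta datum `E` with `E.etaDd = η̈♯ := etaDdχq`, every `X̲̲`-choice `C`):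
* `zPartχq_toTheta_inr` — the `z`-part of `θ(inr σ)` is `1` (the section has trivial `Γ`-part, `y`-coordinate `0`);
* `res_etaDdχq_eq_mk` (`rfl`) / `resCocycle_inflCocycle_zFunχq_inr` — `η̈♯` restricted to any `H ≤ Π^tp_Ÿ` is represented by the inflated
  `z`-cocycle, which VANISHES at `inr σ`;
* `exists_rootLift_inr_eq` — hence the root `rootLift C` (`[rootLift] = res η̈♯`, abc-iut-L6-t1's `rootLift_mk`) is a `Δ_Θ`-COBOUNDARY on
  the section: `rootLift(inr σ) = a · θ(inr σ) a⁻¹ θ(inr σ)⁻¹` for one `a ∈ Δ_Θ`;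
* **`res_rootLiftClass_pow_eq_one`** — for every `D' ≤ Π_Ÿ(Π)` consisting of section elements, `(res_{D'} η̲̈^Θ)^l = 1` in `H¹(D', l·Δ_Θ)`
  (the `l`-th power is the `l·Δ_Θ`-coboundary of `a^{−l}`; commutation inside `Δ_Θ`);
* **`hstd_rootMember_of_section`** — the closer's standard-type clause `(2l) • resDmuOf C D' hD etaStd = 0` HOLDS for `etaStd :=` the ROOT
  member `(h1Top C).symm (ofMul (rootLiftClass C))` of the orbit `η̈^{Θ,l·ℤ×μ₂}`.
The model's reading of «`Θ̈(μ_-) ∈ μ_{2l}`» is thus «the theta class is trivial on the Galois section».  Consumer: file 2/2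
`ThetaEvaluationCor112AtModelTateSectionStd` (the Cor. 1.12 instance with `etaStd hmem hstd` and `β hφ hβ` discharged).

HONEST LABEL: SEMI-SYNTHETIC model (no theta FUNCTION; not the tempered `π₁` of a curve); a statement about OUR model class `etaDdχq`,
not about print's `Θ̈`; nothing of [IUTchII] (claim key `Mochizuki2012`, DISPUTED) or [EtTh] asserted beyond the tree's proofs; no side
taken on [IUTchIII] Cor. 3.12; typed ≠ proved; nothing here says abc is proved or refuted.
-/

noncomputable section

namespace Literature.IUT.HodgeArakelov

open Literature.AnabelianGeometry.AbsoluteAnabelian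
open Literature.AnabelianGeometry.EtaleTheta Literature.AnabelianGeometry.SemiGraphs CohomologySystemOfContH1
open Literature.AnabelianGeometry.EtaleTheta.SettingModel
open Literature.NumberTheory.GaloisRepresentations
open scoped Literature.AnabelianGeometry.EtaleTheta
open scoped IsMulCommutative

namespace ModelTateCarriers

/-! ## §1. The theta class dies on the Galois section -/

section ZPart

variable (p : ℕ) [Fact p.Prime] (i j : ℤ) (hj : Even j)

/-- The `z`-part of `θ(inr σ)` is trivial: the Galois section has `y`-coordinate `0` and trivial `Γ`-part. [cite: MochizukiEtTh2009, Prop 1.5 (iii) p.23] -/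
theorem zPartχq_toTheta_inr (σ : GQp p) :
    zPartχq p i j (CurveTheta.toTheta (curveχq p i j) (SemidirectProduct.inr σ)) = 1 := by
  rw [zPartχq_def, refLiftχq_def, ← map_inv, ← map_mul, mul_refReprχq_inv_eq_inl, yCoordχq_apply,
    SemidirectProduct.left_inr, map_one, map_one, map_one, inv_one, mul_one, map_one, map_one]

/-- The model class `η̈♯ = etaDdχq` restricted to any `H ≤ Π^tp_Ÿ` is represented by the (inflated, restricted) `z`-cocycle (`rfl`).
[cite: MochizukiEtTh2009, Prop 1.5 (iii) p.23] -/
theorem res_etaDdχq_eq_mk (H : Subgroup (PiTpχq p i j)) (hH : H ≤ (ThetaSetting.modelχq p i j hj).GtpYdd) :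
    ContH1.res (ThetaSetting.modelχq p i j hj).toTheta (ThetaSetting.modelχq p i j hj).DeltaTheta hH (etaDdχq p i j hj) =
      ContH1.mk
        (ContH1.resCocycle (ThetaSetting.modelχq p i j hj).toTheta (ThetaSetting.modelχq p i j hj).DeltaTheta hH
          (ContH1.inflCocycle (ThetaSetting.modelχq p i j hj).DeltaTheta (ThetaSetting.modelχq p i j hj).toTheta
            (ThetaSetting.modelχq p i j hj).continuous_toTheta le_rfl
            ⟨zFunχq p i j hj _ (Subgroup.map_mono (ThetaSetting.modelχq p i j hj).GtpYdd_le_GtpY),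
              zFunχq_mem p i j hj _ (Subgroup.map_mono (ThetaSetting.modelχq p i j hj).GtpYdd_le_GtpY)⟩)).1
        (ContH1.resCocycle (ThetaSetting.modelχq p i j hj).toTheta (ThetaSetting.modelχq p i j hj).DeltaTheta hH
          (ContH1.inflCocycle (ThetaSetting.modelχq p i j hj).DeltaTheta (ThetaSetting.modelχq p i j hj).toTheta
            (ThetaSetting.modelχq p i j hj).continuous_toTheta le_rfl
            ⟨zFunχq p i j hj _ (Subgroup.map_mono (ThetaSetting.modelχq p i j hj).GtpYdd_le_GtpY),
              zFunχq_mem p i j hj _ (Subgroup.map_mono (ThetaSetting.modelχq p i j hj).GtpYdd_le_GtpY)⟩)).2 :=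
  rfl

/-- … whose value at `inr σ ∈ H` is `1`. [cite: MochizukiEtTh2009, Prop 1.5 (iii) p.23] -/
theorem resCocycle_inflCocycle_zFunχq_inr (H : Subgroup (PiTpχq p i j)) (hH : H ≤ (ThetaSetting.modelχq p i j hj).GtpYdd)
    (σ : GQp p) (hσ : (SemidirectProduct.inr σ : PiTpχq p i j) ∈ H) :
    (ContH1.resCocycle (ThetaSetting.modelχq p i j hj).toTheta (ThetaSetting.modelχq p i j hj).DeltaTheta hH
          (ContH1.inflCocycle (ThetaSetting.modelχq p i j hj).DeltaTheta (ThetaSetting.modelχq p i j hj).toTheta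
            (ThetaSetting.modelχq p i j hj).continuous_toTheta le_rfl
            ⟨zFunχq p i j hj _ (Subgroup.map_mono (ThetaSetting.modelχq p i j hj).GtpYdd_le_GtpY),
              zFunχq_mem p i j hj _ (Subgroup.map_mono (ThetaSetting.modelχq p i j hj).GtpYdd_le_GtpY)⟩)).1
        ⟨SemidirectProduct.inr σ, hσ⟩ = 1 := by
  apply Subtype.ext
  change zPartχq p i j (CurveTheta.toTheta (curveχq p i j) (SemidirectProduct.inr σ)) = 1
  exact zPartχq_toTheta_inr p i j σ

end ZPart

section RootOnSection

variable (p : ℕ) [Fact p.Prime] (i j : ℤ) (hj : Even j)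
  {E : (ThetaSetting.modelχq p i j hj).EtaleThetaData} {l : ℕ} (C : E.DoubleUnderline l)

/-- `(mk f)^n = mk (f^n)` in `ContH1` (powers of classes are classes of pointwise powers). [cite: NeukirchSchmidtWingberg2008, I §2 and II §7] -/
theorem contH1_mk_pow {G G' : Type} [Group G] [TopologicalSpace G] [Group G'] [TopologicalSpace G']
    [IsTopologicalGroup G'] (φ : G →* G') (A : Subgroup G') [A.Normal] [IsMulCommutative A] {H : Subgroup G}
    (f : H → A) (hf : f ∈ contCocycles φ A H) (n : ℕ) :
    ContH1.mk f hf ^ n = ContH1.mk (f ^ n) (pow_mem hf n) := by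
  induction n with
  | zero =>
    rw [pow_zero, ← ContH1.mk_one (φ := φ) (A' := A) (H := H)]
    exact ContH1.mk_congr H (pow_zero f).symm _ _
  | succ n ih =>
    rw [pow_succ, ih, ContH1.mk_mul_mk]
    exact ContH1.mk_congr H (pow_succ f n).symm _ _

/-- **On the section, a root of `η̈♯` is a `Δ_Θ`-coboundary**: if `E.etaDd = η̈♯` (the model class), then for every
`X̲̲`-choice `C` there is `a ∈ Δ_Θ` with `rootLift(x) = a · (θ(x) a⁻¹ θ(x)⁻¹)` for every `x = inr σ ∈ Π^tp_{Ÿ̲̲}`.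
[cite: MochizukiEtTh2009, Def 2.7 p.41] -/
theorem exists_rootLift_inr_eq (hE : E.etaDd = etaDdχq p i j hj) :
    ∃ a : (ThetaSetting.modelχq p i j hj).DeltaTheta, ∀ (σ : GQp p)
      (hσ : (SemidirectProduct.inr σ : PiTpχq p i j) ∈ C.GtpYdduu),
      (EtaleThetaDataOfSetting.rootLift C).1 ⟨SemidirectProduct.inr σ, hσ⟩ =
        a * MulAut.conjNormal ((ThetaSetting.modelχq p i j hj).toTheta (SemidirectProduct.inr σ)) a⁻¹ := by
  have hmk := EtaleThetaDataOfSetting.rootLift_mk C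
  rw [hE, res_etaDdχq_eq_mk p i j hj C.GtpYdduu inf_le_left] at hmk
  obtain ⟨a, ha⟩ := (ContH1.mk_eq_mk_iff _ _ _ _ _).1 hmk
  refine ⟨a, fun σ hσ => ?_⟩
  have h := ha ⟨SemidirectProduct.inr σ, hσ⟩
  rw [resCocycle_inflCocycle_zFunχq_inr p i j hj C.GtpYdduu inf_le_left σ hσ, mul_one] at h
  -- `h : (f x)⁻¹ = conj a * a⁻¹`
  have h' : (EtaleThetaDataOfSetting.rootLift C).1 ⟨SemidirectProduct.inr σ, hσ⟩ =
      (MulAut.conjNormal ((ThetaSetting.modelχq p i j hj).toTheta (SemidirectProduct.inr σ)) a * a⁻¹)⁻¹ := by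
    rw [← h, inv_inv]
  rw [h', mul_inv_rev, inv_inv, map_inv]


-- the generic instances of the coefficient subgroup `l·Δ_Θ`, re-supplied at the (reducible) model carriers by the consumer
variable [((ThetaSetting.modelχq p i j hj).lDeltaTheta l).Normal] [IsMulCommutative ((ThetaSetting.modelχq p i j hj).lDeltaTheta l)]

/-- **The restriction of the root class to any subgroup of the section is `l`-torsion**: for `D' ≤ Π_Ÿ(Π)` consisting of
section elements `inr σ`, `(res_{D'} η̲̈^Θ)^l = 1` in `H¹(D', l·Δ_Θ)` — the cocycle is `x ↦ a · θ(x) a⁻¹ θ(x)⁻¹` there, whose `l`-th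
power is the `l·Δ_Θ`-coboundary of `a^{-l} ∈ l·Δ_Θ`. [cite: MochizukiEtTh2009, Def 2.7 p.41] -/
theorem res_rootLiftClass_pow_eq_one (hE : E.etaDd = etaDdχq p i j hj) (D' : Subgroup (EtaleThetaDataOfSetting.Pi C))
    (hD : D' ≤ EtaleThetaDataOfSetting.PiYdd C ⊓ ⊤)
    (hsec : ∀ d : EtaleThetaDataOfSetting.Pi C, d ∈ D' → ∃ σ : GQp p, SemidirectProduct.inr σ = (d : PiTpχq p i j)) :
    (ContH1.res (EtaleThetaDataOfSetting.phi C) ((ThetaSetting.modelχq p i j hj).lDeltaTheta l) hD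
      (EtaleThetaDataOfSetting.rootLiftClass C)) ^ l = 1 := by
  obtain ⟨a, ha⟩ := exists_rootLift_inr_eq p i j hj C hE
  have hb : (((a⁻¹ ^ l : (ThetaSetting.modelχq p i j hj).DeltaTheta) : (ThetaSetting.modelχq p i j hj).GtpTheta)) ∈
      (ThetaSetting.modelχq p i j hj).lDeltaTheta l :=
    ⟨((a⁻¹ : (ThetaSetting.modelχq p i j hj).DeltaTheta) : (ThetaSetting.modelχq p i j hj).GtpTheta), (a⁻¹).2,
      by rw [SubgroupClass.coe_pow]⟩
  change (ContH1.mk ((ContH1.resCocycle (EtaleThetaDataOfSetting.phi C) _ hD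
      ⟨EtaleThetaDataOfSetting.liftCocycle C ⊤ (EtaleThetaDataOfSetting.rootLift C).1 (EtaleThetaDataOfSetting.rootLift_val C),
        EtaleThetaDataOfSetting.liftCocycle_mem C ⊤ _ (EtaleThetaDataOfSetting.rootLift C).2 _⟩).1) _) ^ l = 1
  rw [contH1_mk_pow, ContH1.mk_eq_one_iff, mem_contCoboundaries_iff]
  refine ⟨⟨_, hb⟩, funext fun d => Subtype.ext ?_⟩
  obtain ⟨σ, hσ⟩ := hsec d.1 d.2
  have hσY : (SemidirectProduct.inr σ : PiTpχq p i j) ∈ C.GtpYdduu := by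
    rw [hσ]; exact Subgroup.mem_subgroupOf.mp (Subgroup.mem_inf.mp (hD d.2)).1
  -- the value of the restricted lift at `d`, through `ha`
  have hval : ((((ContH1.resCocycle (EtaleThetaDataOfSetting.phi C) _ hD
      ⟨EtaleThetaDataOfSetting.liftCocycle C ⊤ (EtaleThetaDataOfSetting.rootLift C).1 (EtaleThetaDataOfSetting.rootLift_val C),
        EtaleThetaDataOfSetting.liftCocycle_mem C ⊤ _ (EtaleThetaDataOfSetting.rootLift C).2 _⟩).1) d :
        (ThetaSetting.modelχq p i j hj).lDeltaTheta l) : (ThetaSetting.modelχq p i j hj).GtpTheta) =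
      (a : (ThetaSetting.modelχq p i j hj).GtpTheta) *
        ((ThetaSetting.modelχq p i j hj).toTheta (SemidirectProduct.inr σ) * (a : (ThetaSetting.modelχq p i j hj).GtpTheta)⁻¹ *
          ((ThetaSetting.modelχq p i j hj).toTheta (SemidirectProduct.inr σ))⁻¹) := by
    have hx : EtaleThetaDataOfSetting.toYdduu C ⊤ ⟨d.1, hD d.2⟩ = ⟨SemidirectProduct.inr σ, hσY⟩ := Subtype.ext hσ.symm
    change (((EtaleThetaDataOfSetting.rootLift C).1 (EtaleThetaDataOfSetting.toYdduu C ⊤ ⟨d.1, hD d.2⟩) :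
      (ThetaSetting.modelχq p i j hj).DeltaTheta) : (ThetaSetting.modelχq p i j hj).GtpTheta) = _
    rw [hx, ha σ hσY, Subgroup.coe_mul, MulAut.conjNormal_apply, InvMemClass.coe_inv]
  have hφ : EtaleThetaDataOfSetting.phi C (d : EtaleThetaDataOfSetting.Pi C) =
      (ThetaSetting.modelχq p i j hj).toTheta (SemidirectProduct.inr σ) := by
    change (ThetaSetting.modelχq p i j hj).toTheta ((d : EtaleThetaDataOfSetting.Pi C) : PiTpχq p i j) = _
    rw [hσ]
  rw [Pi.pow_apply, SubgroupClass.coe_pow, hval, Subgroup.coe_mul, MulAut.conjNormal_apply, InvMemClass.coe_inv, hφ]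
  -- the group identity `(u · (c u⁻¹ c⁻¹))^l = c (u⁻¹)^l c⁻¹ · ((u⁻¹)^l)⁻¹`, from commutation inside `Δ_Θ`
  set u : (ThetaSetting.modelχq p i j hj).GtpTheta := (a : (ThetaSetting.modelχq p i j hj).GtpTheta) with hu
  set c : (ThetaSetting.modelχq p i j hj).GtpTheta := (ThetaSetting.modelχq p i j hj).toTheta (SemidirectProduct.inr σ) with hc
  have huΔ : u ∈ (ThetaSetting.modelχq p i j hj).DeltaTheta := a.2
  have hvΔ : c * u⁻¹ * c⁻¹ ∈ (ThetaSetting.modelχq p i j hj).DeltaTheta :=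
    (inferInstance : (ThetaSetting.modelχq p i j hj).DeltaTheta.Normal).conj_mem _ (inv_mem huΔ) c
  have hwΔ : c * (u ^ l)⁻¹ * c⁻¹ ∈ (ThetaSetting.modelχq p i j hj).DeltaTheta :=
    (inferInstance : (ThetaSetting.modelχq p i j hj).DeltaTheta.Normal).conj_mem _ (inv_mem (pow_mem huΔ l)) c
  have h1 : Commute u (c * u⁻¹ * c⁻¹) := (ThetaSetting.modelχq p i j hj).ker_thetaToEll_comm u huΔ _ hvΔ
  have h2 : Commute (u ^ l) (c * (u ^ l)⁻¹ * c⁻¹) := (ThetaSetting.modelχq p i j hj).ker_thetaToEll_comm _ (pow_mem huΔ l) _ hwΔ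
  rw [SubgroupClass.coe_pow, InvMemClass.coe_inv, h1.mul_pow, conj_pow, inv_pow, inv_inv, h2.eq]

/-- **hstd at the section**: the standard-type clause «the restriction of `η` to `D_{μ_-}` is a `2l`-th root of unity» HOLDS at
`D_{μ_-} ⊆ Π^tp_{X̲̲} ∩ inr(G_{ℚ_p})` for `etaStd :=` the ROOT member of the orbit, whenever `E.etaDd = η̈♯`.
[claim: Mochizuki2012, status: disputed] (IUTchII §1 Rmk 1.4.1 (ii), kurims p.29) -/
theorem hstd_rootMember_of_section (hE : E.etaDd = etaDdχq p i j hj) (D' : Subgroup (EtaleThetaDataOfSetting.Pi C))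
    (hD : D' ≤ EtaleThetaDataOfSetting.PiYdd C)
    (hsec : ∀ d : EtaleThetaDataOfSetting.Pi C, d ∈ D' → ∃ σ : GQp p, SemidirectProduct.inr σ = (d : PiTpχq p i j)) :
    (2 * l) • EtaleThetaDataOfSetting.resDmuOf C D' hD
      ((EtaleThetaDataOfSetting.h1Top C).symm (Additive.ofMul (EtaleThetaDataOfSetting.rootLiftClass C))) = 0 := by
  have h := res_rootLiftClass_pow_eq_one p i j hj C hE D'
    (fun x hx => Subgroup.mem_inf.mpr ⟨hD hx, Subgroup.mem_top x⟩) hsec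
  change (2 * l) • (MonoidHom.toAdditive (ContH1.res (EtaleThetaDataOfSetting.phi C)
      ((ThetaSetting.modelχq p i j hj).lDeltaTheta l) _))
    ((EtaleThetaDataOfSetting.h1Top C) ((EtaleThetaDataOfSetting.h1Top C).symm
      (Additive.ofMul (EtaleThetaDataOfSetting.rootLiftClass C)))) = 0
  rw [AddEquiv.apply_symm_apply, MonoidHom.toAdditive_apply_apply, toMul_ofMul, ← ofMul_pow, mul_comm, pow_mul, h, one_pow,
    ofMul_one]

end RootOnSection

end ModelTateCarriers

end Literature.IUT.HodgeArakelov

end
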